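import Summits.KontsevichZagierPeriods.KontsevichZagierPeriods.Theses.TorsionLogs
import Summits.KontsevichZagierPeriods.KontsevichZagierPeriods.Theorems.TorsionLogsNeronTorsionSector
import Literature.NumberTheory.Transcendental.KZKernelConjectureForms

/-!
# Crux `TorsionSectorComplete` (stmt-KontsevichZagierPeriods-14212) — line `NeronTorsionArgument`
# (forward generator G1 `next-rung` over the floor `NeronTorsionPrimitiveChain`, unit fwd2-rung-KontsevichZagierPeriods-01, gen 15)

Route `TorsionLogs` (route-KontsevichZagierPeriods-TorsionLogs; `closes (h₁ : NeronTorsionSector)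
(h₂ : TorsionSectorComplete) : KontsevichZagierPeriods`; `h₁` CLOSED by the landed translation chain, `h₂` the open
residual).  Floor = the CLOSED primitive chain `Theses.TorsionLogs.NeronTorsionPrimitiveChain`
(`Cruxes.NeronTorsionSector.Translation.stub_assembly`, seed g1-KontsevichZagierPeriods-17981).

## The rung: the ARGUMENT of a division value — π enters the torsion sector (imaginary part of the complex Néron primitive)

The floor and all fourteen forward lines filed on it read the Néron FUNCTION `λ = Re Λ̃` — a REAL number, the log of
the MODULUS of a division value: `q²•[rI] + p²•[rP] − c•[log B]`.  Line `NeronTorsionComplex` (gen 8) moved the torsion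
point off the real locus (`P ∈ E(ℂ) ∖ E(ℝ)` on a real curve, `N·u_P = a·ω₁ + b·ω₂`) but still read the REAL PART of the
complex triangle `I_ℂ(P) = ∬_{0<s'<s<1} (x_P−e₁)² x(s') ds' ds/(y_c(s') y_c(s))` along the segment `x(s) = e₁ + s(x_P − e₁)`,
and proved it by FOLDING the conjugate pair `(P, P̄)` onto two real points.  The holomorphic primitive
`Λ̃(u) = −log σ(u) + (η₁/2ω₁)u² = −log ϑ₁(πu/ω₁) + const` has an IMAGINARY PART, and at a torsion point it is NOT a
logarithm: by the quasi-periodicity of `ϑ₁` — whose multiplier `e^{−2ib·v} q^{−b²}` is LEGENDRE's relation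
`η₁ω₂ − η₂ω₁ = 2πi` — and the division polynomial `ψ_{N+1}` (`(N+1)P = P`),

  (★)  `N(N+2)·[ Im I_ℂ(P) − ((N−2a)b/N²)·η₁W₀ ] − π·ab(N+2)/N ≡ arg ψ_{N+1}(P)   (mod π·ℤ)`,

`W₀ = ∫_{e₂}^{e₁} dx/√(−f)` (`ω₂ = 2iW₀`), `η₁ = ∫_{e₁}^∞ (g₂x+2g₃) dx/(2x²√f)`, `ψ_{N+1}(P) ∈ ℚ̄` (an algebraic complex
number, so `arg ψ_{N+1}(P) ≡ arctan(Im ψ/Re ψ)` is the period `∫₀^γ dt/(1+t²)` at an algebraic end point).  Checked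
numerically (folder `num/im_torsion.py`, composite Gauss–Legendre, pure python): on `y² = 4x³ − 28x + 24`,
`P = (1 − 2i, 4 + 8i)` of order `4`, `u_P = (ω₁ + ω₂)/4` (`a = b = 1`): the holomorphic dictionary
`I_ℂ(P) = Λ̃(u_P) − Λ̃(ω₁/2) − (η₁/2ω₁)(ω₁/2 − u_P)²` to `3·10⁻¹²`, `ψ₅(P) = 2¹⁵(44 − 117i)`, and

  `48·Im I_ℂ(P) − 6·η₁W₀ + 7·π + 2·arctan(117/44) = 0`   (to `10⁻¹⁰`; `Im I_ℂ(P) = −0.394259684394…`, `η₁W₀ = 0.914810396…`),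

i.e. the tied element `48•[rJ] − 6•[rW] + 7•[rD] + 2•[rA(117/44)]` (tie `N²k₁ + M(N−2a)b = 16·(−6) + 48·2·1 = 0`).
NEW OBJECTS in the sector: the π-carrier `rD = [ℝ, dt/(1+t²)]`, arctangent carriers `rA = [0<t<γ, dt/(1+t²)]` (arguments of
algebraic numbers), the mixed period product `rW = [(e₂,e₁)×(e₁,∞), (1/√(−f(x)))·(g₂x'+2g₃)/(2x'²√f(x'))]` of value `W₀η₁`,
and integrands that are IMAGINARY PARTS of algebraic functions along a complex segment.

WHY THIS IS ONE MOVE OVER THE FLOOR AND NOT GEN 8 AGAIN.  The datum generalised is the same as gen 8's (real torsion point ↦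
complex torsion point of the real curve); the read-out is the complementary projection `Im` instead of `Re`.  The real part
is conjugation-SYMMETRIC and folds onto `E(ℝ) ∪ E⁻(ℝ)` (gen 8's `ConjugateFold`, two seed instances); the imaginary part is
conjugation-ANTISYMMETRIC — `Λ̃(ū) = conj Λ̃(u)` — so NO parallelogram/fold identity lands it on real points: the proof must
run the floor's translation engine ALONG COMPLEX PATHS (every identity split into real and imaginary parts of
semialgebraic complex-valued integrands), meet the LATTICE TRANSLATION `u ↦ u + bω₂` whose cocycle is Legendre's `2πi`
(landed by moves: `Theorems/UnfoldedStokesLegendreCubicForm.lean`, `…LegendreAllModuli.lean`, value `η₁W₀ + ω₁H₀ = π`),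
and package complex logarithms of algebraic numbers as ARGUMENTS (the tangent addition law by moves, landed in
`Theorems/HurwitzMicroSectorsNormalFormPrincipleAngAddK2.lean :: ang_add_mem_relations` and the signed-angle calculus
`…AngSigned.lean`).  None of π, arctan, `W₀`, `2πi` occurs in the floor's proof or in any sibling line of this crux.

RUNG `NeronTorsionArgument := ∀ b : Bool, NeronArgumentMember b`; member `false` := the floor decl
`Theses.TorsionLogs.NeronTorsionPrimitiveChain` VERBATIM (F3 witness `rung_false := NeronTorsionPrimitiveChain_holds`); member
`true` := `NeronArgumentSector`, the TIED argument sector (tie `N²k₁ + M(N−2a)b = 0`, free integers `k₂, m` on the π- and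
arctan-carriers, value hypothesis — under S every instance holds by soundness of `eval`, F4 `onPath`; unconditionally the
instances are the integer multiples of (★) repackaged by Machin-type relations, `argumentSector_of_chain`).

Stubs (registered): `stub_divisionArgumentChain` (XL, the new move: the primitive ARGUMENT CHAIN
`M•[rJ] + k₁•[rW] − c₁•[rD] − c₂•[rA₀] ∈ relations` on the tie line), `stub_anglePackaging` (M, port of the landed angle
calculus: a vanishing `ℤ`-combination of `π` and two arctangents of positive algebraic numbers is a chain of moves),
`stub_argumentSectorComplete` (residual: completeness modulo `relations ⊔ closure (T ∪ T_arg)`, WEAKER than the crux,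
conjecture-grade, declared residual).  Sorry-free: `argumentSector_of_chain` (soundness of `eval` + packaging),
`NeronTorsionArgument_of` (= `Rung_of`), `rung_false` (F3), `neronTorsionArgument_of_kontsevichZagierPeriods` / `onPath` (F4),
`closure_argumentTied_le_relations`, `argumentSectorComplete_of_torsionSectorComplete`, `TorsionSectorComplete_of`
(the crux BY NAME).
PRIOR ART FOR THE VALUE IDENTITY (not for its realisation by moves): the Klein form `𝔨(z) = e^{−η(z)z/2}σ(z)` satisfies
`𝔨_{a+b}(W) = ε(a,b)𝔨_a(W)`, `ε(a,b) = (−1)^{b₁b₂+b₁+b₂} e^{−2πi(b₁a₂−b₂a₁)/2}` (Lang, *Elliptic Functions*, Ch. 19 §1, K 2 — the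
`2πi` is Legendre's relation) and `𝔨_a^{2N}` is a modular form on `Γ(N)` for `a ∈ (1/N)ℤ² ∖ ℤ²` (ibid. Thm 1; Siegel
`g_a^{12N}` on `Γ(N)`, Thm 2), so at an `N`-torsion point of a curve over `ℚ̄` the ARGUMENT of the Klein value is
`(rational)·π + (1/2N)·arg(algebraic)`; the Néron function is `−log|𝔨·Δ^{1/12}| = ½·Re(…)` (Silverman, *Advanced Topics*,
VI Thm 3.2) — the literature keeps the modulus and discards exactly the argument this rung realises as a period identity.
[cite: KontsevichZagier2001, §1.1–1.2] [cite: Lang1983, Ch. 13 Thm 1.1; Ch. 18 §1 (σ, ϑ₁, Legendre)] [cite: Lang1987, Ch. 19 §1 K 2, Thm 1, §2 Thm 2 (Klein forms, Siegel functions)] [cite: Silverman1994, VI Prop 3.1, Thm 3.2] [cite: Lawden1989, §1.3 (1.3.1)–(1.3.2) (quasi-period πτ of ϑ₁), §6.2 (6.2.5)–(6.2.7) (σ(u+2ω₃), the −iπ/ω₁ term)]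
-/

noncomputable section

open Set MeasureTheory Filter Topology
open Literature.NumberTheory.Transcendental Literature.ModelTheory.ExponentialFields
open Summit.KontsevichZagierPeriods.KontsevichZagierPeriods.Theses.TorsionLogs (NeronTorsionSector NeronTorsionPrimitiveChain
  NeronTorsionPrimitiveChain_holds TorsionSectorComplete)
open Summit.KontsevichZagierPeriods.KontsevichZagierPeriods.Cruxes.NeronTorsionSector.Translation (NeronTorsionSector_of)

-- `Summit.KontsevichZagierPeriods.KontsevichZagierPeriods.…` is the tree's mandated layout (single-conjunct summit).
set_option linter.dupNamespace false

namespace Summit.KontsevichZagierPeriods.KontsevichZagierPeriods.Cruxes.TorsionSectorComplete.NeronTorsionArgument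

/-! ### Statements -/

/-- **Member `true`: the TIED NÉRON ARGUMENT SECTOR.**  Data (gen 8's complex-torsion data verbatim): a real Weierstrass
curve `y² = f(x) = 4x³ − g₂x − g₃`, `g₂³ ≠ 27g₃²`, roots `e₂ < e₁`, `0 < e₁`, `f > 0` beyond `e₁`, `f < 0` on `(e₂, e₁)`; a
NON-REAL point `P = (x_P, y_P)`, `Im x_P ≠ 0`; the continuous branch `y_c` of `y` along `x(s) = e₁ + s(x_P − e₁)`,
`y_c(1) = y_P`; the complex lattice datum `N·(ω₁/2 + ∫₀¹ (x_P−e₁) ds/y_c) = a·ω₁ + b·(2iW₀)`, `0 < 2a < N`, `0 < 2b < N`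
(principal lift; it makes `P` an `N`-torsion point).  Representations pinned: `rJ = [0<s'<s<1, Im((x_P−e₁)² x(s')/(y_c(s')y_c(s)))]`
(IMAGINARY part of the complex Néron triangle), `rW = [(e₂,e₁)×(e₁,∞), (1/√(−f(x)))·(g₂x'+2g₃)/(2x'²√f(x'))]` (value `W₀η₁`),
`rD = [ℝ, dt/(1+t²)]` (value `π`), `rA = [0<t<γ, dt/(1+t²)]` (value `arctan γ`).  Tie `N²k₁ + M(N−2a)b = 0`; `k₂, m` free;
VALUE HYPOTHESIS `M·rJ + k₁·rW + k₂·rD = m·rA`.  CLAIM: `M•[rJ] + k₁•[rW] + k₂•[rD] − m•[rA] ∈ KZ.relations`.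
[cite: KontsevichZagier2001, §1.2] [cite: Lang1983, Ch. 18 §1] -/
def NeronArgumentSector : Prop :=
  ∀ (g₂ g₃ e₁ e₂ γ : ℝ) (xP yP : ℂ) (yc : ℝ → ℂ) (N a b : ℕ) (M k₁ k₂ m : ℤ) (f : ℝ → ℝ),
    (∀ x, f x = 4 * x ^ 3 - g₂ * x - g₃) → g₂ ^ 3 - 27 * g₃ ^ 2 ≠ 0 → f e₁ = 0 → f e₂ = 0 → e₂ < e₁ → 0 < e₁ →
    (∀ x, e₁ < x → 0 < f x) → (∀ x, e₂ < x → x < e₁ → f x < 0) → xP.im ≠ 0 →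
    yP ^ 2 = 4 * xP ^ 3 - (g₂ : ℂ) * xP - (g₃ : ℂ) → ContinuousOn yc (Set.Icc 0 1) → yc 1 = yP →
    (∀ s ∈ Set.Icc (0 : ℝ) 1,
      yc s ^ 2 = 4 * ((e₁ : ℂ) + (s : ℂ) * (xP - e₁)) ^ 3 - (g₂ : ℂ) * ((e₁ : ℂ) + (s : ℂ) * (xP - e₁)) - (g₃ : ℂ)) →
    (∀ s ∈ Set.Ioc (0 : ℝ) 1, yc s ≠ 0) → 3 ≤ N → 0 < a → 2 * a < N → 0 < b → 2 * b < N →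
    (N : ℂ) * (((∫ x in Set.Ioi e₁, (Real.sqrt (f x))⁻¹ : ℝ) : ℂ) + ∫ s in Set.Ioo (0 : ℝ) 1, (xP - e₁) / yc s) =
      (a : ℂ) * (((2 * ∫ x in Set.Ioi e₁, (Real.sqrt (f x))⁻¹ : ℝ) : ℂ)) +
        (b : ℂ) * (((2 * ∫ x in Set.Ioo e₂ e₁, (Real.sqrt (-f x))⁻¹ : ℝ) : ℂ)) * Complex.I →
    (N : ℤ) ^ 2 * k₁ + M * ((N : ℤ) - 2 * (a : ℤ)) * (b : ℤ) = 0 → 0 < γ →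
    ∀ (rJ rW : KZ.IntegralRep 2) (rD rA : KZ.IntegralRep 1),
    rJ.domain = {z | 0 < z 1 ∧ z 1 < z 0 ∧ z 0 < 1} →
    Set.EqOn rJ.integrand
      (fun z => ((xP - e₁) ^ 2 * ((e₁ : ℂ) + ((z 1 : ℝ) : ℂ) * (xP - e₁)) / (yc (z 1) * yc (z 0))).im) rJ.domain →
    rW.domain = {z | e₂ < z 0 ∧ z 0 < e₁ ∧ e₁ < z 1} →
    Set.EqOn rW.integrand
      (fun z => (Real.sqrt (-f (z 0)))⁻¹ * ((g₂ * z 1 + 2 * g₃) / (2 * (z 1) ^ 2 * Real.sqrt (f (z 1))))) rW.domain →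
    rD.domain = Set.univ → Set.EqOn rD.integrand (fun t => (1 + t 0 ^ 2)⁻¹) rD.domain →
    rA.domain = {t | 0 < t 0 ∧ t 0 < γ} → Set.EqOn rA.integrand (fun t => (1 + t 0 ^ 2)⁻¹) rA.domain →
    (M : ℝ) * rJ.value + k₁ * rW.value + k₂ * rD.value = m * rA.value →
    M • KZ.of rJ + k₁ • KZ.of rW + k₂ • KZ.of rD - m • KZ.of rA ∈ KZ.relations

/-- **The family, graded by the projection read (`false` ↦ real torsion point, real value — the floor; `true` ↦ non-real
torsion point, IMAGINARY part).**  Member `false` is the floor decl `Theses.TorsionLogs.NeronTorsionPrimitiveChain` VERBATIM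
(the seed, CLOSED); member `true` is `NeronArgumentSector`. -/
def NeronArgumentMember : Bool → Prop
  | false => NeronTorsionPrimitiveChain
  | true => NeronArgumentSector

/-- **THE RUNG `NeronTorsionArgument`: both members.** `∀ b, NeronArgumentMember b` — the proved floor and the new argument
sector statement. -/
def NeronTorsionArgument : Prop := ∀ imaginary : Bool, NeronArgumentMember imaginary

/-- **The PRIMITIVE ARGUMENT CHAIN** (the `∃`-form of member `true`, as the floor's primitive chain): same data and pinned
`rJ, rW, rD`, no `γ / k₂ / m / rA` and no value hypothesis; for EVERY `(M, k₁)` on the tie line `N²k₁ + M(N−2a)b = 0` there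
EXIST integers `c₁, c₂`, an algebraic `γ₀ > 0` and an arctangent carrier `rA₀ = [0<t<γ₀, dt/(1+t²)]` with
`M•[rJ] + k₁•[rW] − c₁•[rD] − c₂•[rA₀] ∈ KZ.relations`.  (Value level = the integer multiples of (★):
`M·Im I_ℂ + k₁·η₁W₀ = c₁·π + c₂·arctan γ₀`.) [cite: KontsevichZagier2001, §1.2] [cite: Lang1983, Ch. 18 §1] -/
def ArgumentPrimitiveChain : Prop :=
  ∀ (g₂ g₃ e₁ e₂ : ℝ) (xP yP : ℂ) (yc : ℝ → ℂ) (N a b : ℕ) (f : ℝ → ℝ),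
    (∀ x, f x = 4 * x ^ 3 - g₂ * x - g₃) → g₂ ^ 3 - 27 * g₃ ^ 2 ≠ 0 → f e₁ = 0 → f e₂ = 0 → e₂ < e₁ → 0 < e₁ →
    (∀ x, e₁ < x → 0 < f x) → (∀ x, e₂ < x → x < e₁ → f x < 0) → xP.im ≠ 0 →
    yP ^ 2 = 4 * xP ^ 3 - (g₂ : ℂ) * xP - (g₃ : ℂ) → ContinuousOn yc (Set.Icc 0 1) → yc 1 = yP →
    (∀ s ∈ Set.Icc (0 : ℝ) 1,
      yc s ^ 2 = 4 * ((e₁ : ℂ) + (s : ℂ) * (xP - e₁)) ^ 3 - (g₂ : ℂ) * ((e₁ : ℂ) + (s : ℂ) * (xP - e₁)) - (g₃ : ℂ)) →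
    (∀ s ∈ Set.Ioc (0 : ℝ) 1, yc s ≠ 0) → 3 ≤ N → 0 < a → 2 * a < N → 0 < b → 2 * b < N →
    (N : ℂ) * (((∫ x in Set.Ioi e₁, (Real.sqrt (f x))⁻¹ : ℝ) : ℂ) + ∫ s in Set.Ioo (0 : ℝ) 1, (xP - e₁) / yc s) =
      (a : ℂ) * (((2 * ∫ x in Set.Ioi e₁, (Real.sqrt (f x))⁻¹ : ℝ) : ℂ)) +
        (b : ℂ) * (((2 * ∫ x in Set.Ioo e₂ e₁, (Real.sqrt (-f x))⁻¹ : ℝ) : ℂ)) * Complex.I →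
    ∀ (M k₁ : ℤ), (N : ℤ) ^ 2 * k₁ + M * ((N : ℤ) - 2 * (a : ℤ)) * (b : ℤ) = 0 →
    ∀ (rJ rW : KZ.IntegralRep 2) (rD : KZ.IntegralRep 1),
    rJ.domain = {z | 0 < z 1 ∧ z 1 < z 0 ∧ z 0 < 1} →
    Set.EqOn rJ.integrand
      (fun z => ((xP - e₁) ^ 2 * ((e₁ : ℂ) + ((z 1 : ℝ) : ℂ) * (xP - e₁)) / (yc (z 1) * yc (z 0))).im) rJ.domain →
    rW.domain = {z | e₂ < z 0 ∧ z 0 < e₁ ∧ e₁ < z 1} →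
    Set.EqOn rW.integrand
      (fun z => (Real.sqrt (-f (z 0)))⁻¹ * ((g₂ * z 1 + 2 * g₃) / (2 * (z 1) ^ 2 * Real.sqrt (f (z 1))))) rW.domain →
    rD.domain = Set.univ → Set.EqOn rD.integrand (fun t => (1 + t 0 ^ 2)⁻¹) rD.domain →
    ∃ (c₁ c₂ : ℤ) (γ₀ : ℝ) (rA₀ : KZ.IntegralRep 1), 0 < γ₀ ∧ IsAlgebraic ℚ γ₀ ∧
      rA₀.domain = {t | 0 < t 0 ∧ t 0 < γ₀} ∧ Set.EqOn rA₀.integrand (fun t => (1 + t 0 ^ 2)⁻¹) rA₀.domain ∧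
      M • KZ.of rJ + k₁ • KZ.of rW - c₁ • KZ.of rD - c₂ • KZ.of rA₀ ∈ KZ.relations

/-- **ANGLE PACKAGING** (the arctangent analogue of the landed interval-log calculus): for the π-carrier `rD = [ℝ, dt/(1+t²)]`
and two arctangent carriers `rAᵢ = [0<t<γᵢ, dt/(1+t²)]`, `γᵢ > 0` (algebraic automatically: `(0, γᵢ)` is
`ℚ`-semialgebraic, `isAlgebraic_of_arctanRep`), every VANISHING integer combination of the values
`n₀·π + n₁·arctan γ₁ + n₂·arctan γ₂ = 0` is a chain of moves: `n₀•[rD] + n₁•[rA₁] + n₂•[rA₂] ∈ KZ.relations`.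
(Exponentiating, `((1+iγ₁)/(1−iγ₁))^{n₁}((1+iγ₂)/(1−iγ₂))^{n₂} = 1`; the moves are the tangent addition law as one Möbius
rotation — `Theorems/HurwitzMicroSectorsNormalFormPrincipleAngAddK2.lean :: ang_add_mem_relations` — iterated with the
quarter-turn bookkeeping of `…AngSigned.lean`, and `[ℝ] = 4·[(0,1)]` by `t ↦ −t`, `t ↦ 1/t`.)
[cite: KontsevichZagier2001, §1.2 rules (1),(2)] -/
def AnglePackaging : Prop :=
  ∀ (n₀ n₁ n₂ : ℤ) (γ₁ γ₂ : ℝ) (rD rA₁ rA₂ : KZ.IntegralRep 1), 0 < γ₁ → 0 < γ₂ →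
    rD.domain = Set.univ → Set.EqOn rD.integrand (fun t => (1 + t 0 ^ 2)⁻¹) rD.domain →
    rA₁.domain = {t | 0 < t 0 ∧ t 0 < γ₁} → Set.EqOn rA₁.integrand (fun t => (1 + t 0 ^ 2)⁻¹) rA₁.domain →
    rA₂.domain = {t | 0 < t 0 ∧ t 0 < γ₂} → Set.EqOn rA₂.integrand (fun t => (1 + t 0 ^ 2)⁻¹) rA₂.domain →
    (n₀ : ℝ) * rD.value + n₁ * rA₁.value + n₂ * rA₂.value = 0 →
    n₀ • KZ.of rD + n₁ • KZ.of rA₁ + n₂ • KZ.of rA₂ ∈ KZ.relations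

/-- The tied Néron–torsion elements `T` of the crux (copied verbatim from the route file, so that `TorsionSectorComplete`
unfolds to completeness relative to `relations ⊔ closure T` by `Iff.rfl`). [cite: KontsevichZagier2001, §1.2] -/
def TorsionTied : Set Literature.NumberTheory.Transcendental.KZ.FormalRep := {d : Literature.NumberTheory.Transcendental.KZ.FormalRep | ∃ (g₂ g₃ e₁ xP yP α : ℝ) (N a : ℕ) (M k m : ℤ) (f : ℝ → ℝ) (rI rP : Literature.NumberTheory.Transcendental.KZ.IntegralRep 2) (rL : Literature.NumberTheory.Transcendental.KZ.IntegralRep 1), (∀ x, f x = 4 * x ^ 3 - g₂ * x - g₃) ∧ g₂ ^ 3 - 27 * g₃ ^ 2 ≠ 0 ∧ f e₁ = 0 ∧ 0 < e₁ ∧ (∀ x, e₁ < x → 0 < f x) ∧ e₁ < xP ∧ yP ^ 2 = f xP ∧ 3 ≤ N ∧ 0 < a ∧ 2 * a < N ∧ 4 * (N : ℤ) ^ 2 * k = M * ((N : ℤ) - 2 * (a : ℤ)) ^ 2 ∧ (∀ hns : (⟨0, 0, 0, -g₂ / 4, -g₃ / 4⟩ : WeierstrassCurve ℝ).toAffine.Nonsingular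 xP (yP / 2), addOrderOf (WeierstrassCurve.Affine.Point.some xP (yP / 2) hns) = N) ∧ (N : ℝ) * (∫ x in Set.Ioi xP, (Real.sqrt (f x))⁻¹) = a * (2 * ∫ x in Set.Ioi e₁, (Real.sqrt (f x))⁻¹) ∧ 1 < α ∧ rI.domain = {z | e₁ < z 1 ∧ z 1 < z 0 ∧ z 0 < xP} ∧ Set.EqOn rI.integrand (fun z => z 1 / (Real.sqrt (f (z 1)) * Real.sqrt (f (z 0)))) rI.domain ∧ rP.domain = {z | e₁ < z 0 ∧ e₁ < z 1} ∧ Set.EqOn rP.integrand (fun z => (Real.sqrt (f (z 0)))⁻¹ * ((g₂ * z 1 + 2 * g₃) / (2 * (z 1) ^ 2 * Real.sqrt (f (z 1))))) rP.domain ∧ rL.domain = {t | 1 < t 0 ∧ t 0 < α} ∧ Set.EqOn rL.integrand (fun t => (t 0)⁻¹) rL.domain ∧ (M : ℝ) * rI.value + k * rP.value = m * rL.value ∧ d = M • Literature.NumberTheory.Transcendental.KZ.of rI + k • Literature.NumberTheory.Transcendental.KZ.of rP - m • Literature.NumberTheory.Transcendental.KZ.of rL}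

/-- The tied Néron ARGUMENT elements `T_arg`: the elements `M•[rJ] + k₁•[rW] + k₂•[rD] − m•[rA]` of member `true` with all its
hypotheses (tie and value hypothesis included). [cite: KontsevichZagier2001, §1.2] -/
def ArgumentTied : Set KZ.FormalRep :=
  {d : KZ.FormalRep | ∃ (g₂ g₃ e₁ e₂ γ : ℝ) (xP yP : ℂ) (yc : ℝ → ℂ) (N a b : ℕ) (M k₁ k₂ m : ℤ) (f : ℝ → ℝ)
    (rJ rW : KZ.IntegralRep 2) (rD rA : KZ.IntegralRep 1),
    (∀ x, f x = 4 * x ^ 3 - g₂ * x - g₃) ∧ g₂ ^ 3 - 27 * g₃ ^ 2 ≠ 0 ∧ f e₁ = 0 ∧ f e₂ = 0 ∧ e₂ < e₁ ∧ 0 < e₁ ∧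
    (∀ x, e₁ < x → 0 < f x) ∧ (∀ x, e₂ < x → x < e₁ → f x < 0) ∧ xP.im ≠ 0 ∧
    yP ^ 2 = 4 * xP ^ 3 - (g₂ : ℂ) * xP - (g₃ : ℂ) ∧ ContinuousOn yc (Set.Icc 0 1) ∧ yc 1 = yP ∧
    (∀ s ∈ Set.Icc (0 : ℝ) 1,
      yc s ^ 2 = 4 * ((e₁ : ℂ) + (s : ℂ) * (xP - e₁)) ^ 3 - (g₂ : ℂ) * ((e₁ : ℂ) + (s : ℂ) * (xP - e₁)) - (g₃ : ℂ)) ∧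
    (∀ s ∈ Set.Ioc (0 : ℝ) 1, yc s ≠ 0) ∧ 3 ≤ N ∧ 0 < a ∧ 2 * a < N ∧ 0 < b ∧ 2 * b < N ∧
    (N : ℂ) * (((∫ x in Set.Ioi e₁, (Real.sqrt (f x))⁻¹ : ℝ) : ℂ) + ∫ s in Set.Ioo (0 : ℝ) 1, (xP - e₁) / yc s) =
      (a : ℂ) * (((2 * ∫ x in Set.Ioi e₁, (Real.sqrt (f x))⁻¹ : ℝ) : ℂ)) +
        (b : ℂ) * (((2 * ∫ x in Set.Ioo e₂ e₁, (Real.sqrt (-f x))⁻¹ : ℝ) : ℂ)) * Complex.I ∧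
    (N : ℤ) ^ 2 * k₁ + M * ((N : ℤ) - 2 * (a : ℤ)) * (b : ℤ) = 0 ∧ 0 < γ ∧
    rJ.domain = {z | 0 < z 1 ∧ z 1 < z 0 ∧ z 0 < 1} ∧
    Set.EqOn rJ.integrand
      (fun z => ((xP - e₁) ^ 2 * ((e₁ : ℂ) + ((z 1 : ℝ) : ℂ) * (xP - e₁)) / (yc (z 1) * yc (z 0))).im) rJ.domain ∧
    rW.domain = {z | e₂ < z 0 ∧ z 0 < e₁ ∧ e₁ < z 1} ∧
    Set.EqOn rW.integrand
      (fun z => (Real.sqrt (-f (z 0)))⁻¹ * ((g₂ * z 1 + 2 * g₃) / (2 * (z 1) ^ 2 * Real.sqrt (f (z 1))))) rW.domain ∧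
    rD.domain = Set.univ ∧ Set.EqOn rD.integrand (fun t => (1 + t 0 ^ 2)⁻¹) rD.domain ∧
    rA.domain = {t | 0 < t 0 ∧ t 0 < γ} ∧ Set.EqOn rA.integrand (fun t => (1 + t 0 ^ 2)⁻¹) rA.domain ∧
    (M : ℝ) * rJ.value + k₁ * rW.value + k₂ * rD.value = m * rA.value ∧
    d = M • KZ.of rJ + k₁ • KZ.of rW + k₂ • KZ.of rD - m • KZ.of rA}

/-- **RESIDUAL (declared): completeness of Kontsevich–Zagier's moves RELATIVE to `relations ⊔ closure (T ∪ T_arg)`.**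
Weaker than the crux as typed (`argumentSectorComplete_of_torsionSectorComplete`); conjecture-grade (GPC-strength).
[cite: KontsevichZagier2001, §1.2] [cite: HuberMullerStach2017, Prop. 13.2.6] -/
def ArgumentSectorComplete : Prop := ∀ ⦃n m : ℕ⦄ (r : KZ.IntegralRep n) (r' : KZ.IntegralRep m),
  r.IsRational → r'.IsRational → r.value = r'.value → KZ.of r - KZ.of r' ∈ KZ.relations ⊔ AddSubgroup.closure (TorsionTied ∪ ArgumentTied)

/-! ### Registered stubs -/

/-- **Stub A (XL, load-bearing, the new move): the primitive ARGUMENT CHAIN** — the floor's translation engine run along the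
complex segment grid `T₁ + k·P` with every identity split into real/imaginary parts, the lattice translation `u ↦ u + bω₂`
(cocycle = Legendre's `2πi`, landed by moves), complex logs of division values packaged as arctangent carriers. -/
theorem stub_divisionArgumentChain : ArgumentPrimitiveChain := by
  sorry

/-- **Stub B (M, port of the landed angle calculus): `AnglePackaging`.** -/
theorem stub_anglePackaging : AnglePackaging := by
  sorry

/-- **Stub D (residual, conjecture-grade): `ArgumentSectorComplete`.** -/
theorem stub_argumentSectorComplete : ArgumentSectorComplete := by
  sorry

/-! ### Proved infrastructure (no `sorry` below this line) -/

/-- The crux unfolds to completeness relative to `relations ⊔ closure T`. -/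
theorem torsionSectorComplete_iff :
    TorsionSectorComplete ↔ ∀ ⦃n m : ℕ⦄ (r : KZ.IntegralRep n) (r' : KZ.IntegralRep m), r.IsRational → r'.IsRational →
      r.value = r'.value → KZ.of r - KZ.of r' ∈ KZ.relations ⊔ AddSubgroup.closure TorsionTied :=
  Iff.rfl

/-- Member `false` is the floor, definitionally. -/
theorem member_false_iff : NeronArgumentMember false ↔ NeronTorsionPrimitiveChain := Iff.rfl

/-- Member `true` is the argument sector statement, definitionally. -/
theorem member_true_iff : NeronArgumentMember true ↔ NeronArgumentSector := Iff.rfl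

/-- The rung is the floor plus the new member. -/
theorem neronTorsionArgument_iff : NeronTorsionArgument ↔ NeronTorsionPrimitiveChain ∧ NeronArgumentSector := by
  constructor
  · exact fun h => ⟨h false, h true⟩
  · rintro ⟨h₀, h₁⟩ (_ | _)
    · exact h₀
    · exact h₁

/-- **F3 WITNESS: the rung at the floor.** Member `false` is the CLOSED seed `NeronTorsionPrimitiveChain`
(`Cruxes.NeronTorsionSector.Translation.stub_assembly`, landed; route link `NeronTorsionPrimitiveChain_holds`). -/
theorem rung_false : NeronArgumentMember false := NeronTorsionPrimitiveChain_holds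

/-- The right end point `γ > 0` of the `ℚ`-semialgebraic domain `(0, γ)` of an arctangent carrier is algebraic: at `(γ)` the
domain is neither a neighbourhood nor a co-neighbourhood (so the arguments packaged by the line are arguments of ALGEBRAIC
numbers automatically). [folklore] -/
theorem isAlgebraic_of_arctanRep {γ : ℝ} (hγ : 0 < γ) (R : KZ.IntegralRep 1)
    (hd : R.domain = {t | 0 < t 0 ∧ t 0 < γ}) : IsAlgebraic ℚ γ := by
  set x : Fin 1 → ℝ := fun _ => γ with hx
  have h := isAlgebraic_of_not_mem_nhds (x := x) R.isSemialgebraic_domain ?_ ?_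
  · simpa [hx] using h
  · intro h
    have hmem : x ∈ R.domain := mem_of_mem_nhds h
    rw [hd] at hmem
    exact lt_irrefl γ (by simpa [hx] using hmem.2)
  · intro h
    obtain ⟨ε, hε, hball⟩ := Metric.mem_nhds_iff.mp h
    set δ : ℝ := min (ε / 2) (γ / 2) with hδ
    have hδpos : 0 < δ := lt_min (by linarith) (by linarith)
    have hδε : δ < ε := (min_le_left _ _).trans_lt (by linarith)
    have hδγ : δ < γ := (min_le_right _ _).trans_lt (by linarith)
    set z : Fin 1 → ℝ := fun _ => γ - δ with hz
    have hzball : z ∈ Metric.ball x ε := by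
      rw [Metric.mem_ball, dist_pi_lt_iff hε]
      intro b
      rw [hz, hx, Real.dist_eq, show γ - δ - γ = -δ by ring, abs_neg, abs_of_pos hδpos]
      exact hδε
    have hzR : z ∈ R.domain := by
      rw [hd]
      change 0 < γ - δ ∧ γ - δ < γ
      constructor <;> linarith
    exact hball hzball hzR

/-- **Bookkeeping: the primitive argument chain and angle packaging give the tied member.**  Soundness of `relations`
(`KZ.relations_le_ker_eval_holds`) on the primitive element and the value hypothesis leave a VANISHING integer combination
`(k₂ + c₁)·rD + c₂·rA₀ − m·rA = 0` of π and two arctangents, which stub B realises by moves; the tied element is the primitive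
one plus that combination. [cite: KontsevichZagier2001, §1.2] -/
theorem argumentSector_of_chain (hA : ArgumentPrimitiveChain) (hB : AnglePackaging) : NeronArgumentSector := by
  intro g₂ g₃ e₁ e₂ γ xP yP yc N a b M k₁ k₂ m f hf hdisc he₁ he₂ h21 he0 hpos hneg hxim hyP hcont hyc1 hycsq hyc0 hN ha
    ha' hb hb' hlat htie hγ rJ rW rD rA hdJ hiJ hdW hiW hdD hiD hdA hiA hval
  obtain ⟨c₁, c₂, γ₀, rA₀, hγ₀, -, hdA₀, hiA₀, hprim⟩ :=
    hA g₂ g₃ e₁ e₂ xP yP yc N a b f hf hdisc he₁ he₂ h21 he0 hpos hneg hxim hyP hcont hyc1 hycsq hyc0 hN ha ha' hb hb'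
      hlat M k₁ htie rJ rW rD hdJ hiJ hdW hiW hdD hiD
  have h0 : (M : ℝ) * rJ.value + k₁ * rW.value - c₁ * rD.value - c₂ * rA₀.value = 0 := by
    have h := KZ.relations_le_ker_eval_holds hprim
    rw [AddMonoidHom.mem_ker] at h
    simp only [map_add, map_sub, map_zsmul, KZ.eval_of, zsmul_eq_mul] at h
    linear_combination h
  have hpack : (k₂ + c₁) • KZ.of rD + c₂ • KZ.of rA₀ + (-m) • KZ.of rA ∈ KZ.relations :=
    hB (k₂ + c₁) c₂ (-m) γ₀ γ rD rA₀ rA hγ₀ hγ hdD hiD hdA₀ hiA₀ hdA hiA (by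
      push_cast
      linear_combination hval - h0)
  have e : M • KZ.of rJ + k₁ • KZ.of rW + k₂ • KZ.of rD - m • KZ.of rA =
      (M • KZ.of rJ + k₁ • KZ.of rW - c₁ • KZ.of rD - c₂ • KZ.of rA₀) +
        ((k₂ + c₁) • KZ.of rD + c₂ • KZ.of rA₀ + (-m) • KZ.of rA) := by
    module
  rw [e]
  exact KZ.relations.add_mem hprim hpack

/-- **The rung from stubs A and B** (the floor is a theorem). -/
theorem NeronTorsionArgument_of (hA : ArgumentPrimitiveChain) (hB : AnglePackaging) : NeronTorsionArgument :=
  neronTorsionArgument_iff.mpr ⟨NeronTorsionPrimitiveChain_holds, argumentSector_of_chain hA hB⟩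

/-- The argument member says exactly `closure T_arg ≤ KZ.relations`. [cite: KontsevichZagier2001, §1.2] -/
theorem closure_argumentTied_le_relations (h : NeronArgumentSector) : AddSubgroup.closure ArgumentTied ≤ KZ.relations := by
  refine (AddSubgroup.closure_le _).mpr ?_
  rintro d ⟨g₂, g₃, e₁, e₂, γ, xP, yP, yc, N, a, b, M, k₁, k₂, m, f, rJ, rW, rD, rA, hf, hdisc, he₁, he₂, h21, he0, hpos,
    hneg, hxim, hyP, hcont, hyc1, hycsq, hyc0, hN, ha, ha', hb, hb', hlat, htie, hγ, hdJ, hiJ, hdW, hiW, hdD, hiD, hdA, hiA,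
    hval, rfl⟩
  exact h g₂ g₃ e₁ e₂ γ xP yP yc N a b M k₁ k₂ m f hf hdisc he₁ he₂ h21 he0 hpos hneg hxim hyP hcont hyc1 hycsq hyc0 hN ha
    ha' hb hb' hlat htie hγ rJ rW rD rA hdJ hiJ hdW hiW hdD hiD hdA hiA hval

/-- The identity-component sector (the route's CLOSED sibling crux `NeronTorsionSector`, landed as
`NeronTorsionSector_of`) says exactly `closure T ≤ KZ.relations`. [cite: KontsevichZagier2001, §1.2] -/
theorem closure_torsionTied_le_relations : AddSubgroup.closure TorsionTied ≤ KZ.relations := by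
  have h : NeronTorsionSector := NeronTorsionSector_of
  refine (AddSubgroup.closure_le _).mpr ?_
  rintro d ⟨g₂, g₃, e₁, xP, yP, α, N, a, M, k, m', f, rI, rP, rL, hf, hdisc, he, he0, hpos, hx, hy, hN, ha,
    ha', htie, hord, htor, hα, hdI, hiI, hdP, hiP, hdL, hiL, hval, rfl⟩
  exact h g₂ g₃ e₁ xP yP α N a M k m' f hf hdisc he he0 hpos hx hy hN ha ha' htie hord htor hα rI rP rL hdI hiI
    hdP hiP hdL hiL hval

/-- **F4 ON-PATH, new member:** Conjecture 1 (kernel form, `kzKernelConjecture_iff_isRational`) gives the tied argument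
statement — the element evaluates to the value hypothesis.  Tagged `@[simp]` so that the tribunal's forward probe
`S → Rung` closes. [cite: KontsevichZagier2001, §1.2] -/
@[simp] theorem argumentSector_of_kontsevichZagierPeriods (h : _root_.KontsevichZagierPeriods) : NeronArgumentSector := by
  have hK : KZKernelConjecture := kzKernelConjecture_iff_isRational.mpr h
  intro g₂ g₃ e₁ e₂ γ xP yP yc N a b M k₁ k₂ m f _ _ _ _ _ _ _ _ _ _ _ _ _ _ _ _ _ _ _ _ _ _ rJ rW rD rA _ _ _ _ _ _ _ _
    hval
  apply hK
  simp only [map_sub, map_add, map_zsmul, KZ.eval_of, zsmul_eq_mul]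
  linear_combination hval

/-- **F4 ON-PATH LEMMA: the summit implies the rung** (member `false` is a theorem outright). -/
@[simp] theorem neronTorsionArgument_of_kontsevichZagierPeriods (h : _root_.KontsevichZagierPeriods) : NeronTorsionArgument :=
  neronTorsionArgument_iff.mpr ⟨NeronTorsionPrimitiveChain_holds, argumentSector_of_kontsevichZagierPeriods h⟩

/-- The same, as an implication (the literal shape `S → Rung` of the forward probe). -/
theorem onPath : _root_.KontsevichZagierPeriods → NeronTorsionArgument :=
  neronTorsionArgument_of_kontsevichZagierPeriods

/-- The residual is a consequence of the crux (hence of the summit): `closure T ≤ closure (T ∪ T_arg)`.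
(Informational: stub D is WEAKER than the crux as typed.) [folklore] -/
theorem argumentSectorComplete_of_torsionSectorComplete (h : TorsionSectorComplete) : ArgumentSectorComplete := by
  intro n m r r' hr hr' hv
  have hmono : KZ.relations ⊔ AddSubgroup.closure TorsionTied ≤
      KZ.relations ⊔ AddSubgroup.closure (TorsionTied ∪ ArgumentTied) :=
    sup_le_sup_left (AddSubgroup.closure_mono Set.subset_union_left) _
  exact hmono (torsionSectorComplete_iff.mp h r r' hr hr' hv)

/-! ### Composition: the crux BY NAME from the three stubs -/

/-- **The folding inequality (sorry-free, stubs A + B as hypotheses):** stubs A + B give the rung's new member, which folds the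
argument sector into the moves (`closure T_arg ≤ relations`), so the residual's `relations ⊔ closure (T ∪ T_arg)` is
`≤ relations ⊔ closure T`. [cite: KontsevichZagier2001, §1.2] -/
theorem sup_closure_le_of_chain_packaging (hA : ArgumentPrimitiveChain) (hB : AnglePackaging) :
    KZ.relations ⊔ AddSubgroup.closure (TorsionTied ∪ ArgumentTied) ≤ KZ.relations ⊔ AddSubgroup.closure TorsionTied := by
  have hR : NeronArgumentSector := argumentSector_of_chain hA hB
  refine sup_le le_sup_left ((AddSubgroup.closure_le _).mpr ?_)
  rintro d (hd | hd)
  · exact AddSubgroup.mem_sup_right (AddSubgroup.subset_closure hd)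
  · exact AddSubgroup.mem_sup_left (closure_argumentTied_le_relations hR (AddSubgroup.subset_closure hd))

/-- **`TorsionSectorComplete` BY NAME from the three registered stubs** — the ONLY theorem of this file concluding the crux;
the implication `ArgumentPrimitiveChain → AnglePackaging → ArgumentSectorComplete → TorsionSectorComplete` is the `suffices`
step (closed term, no `sorry`); `sorry` enters only through `stub_divisionArgumentChain`, `stub_anglePackaging` and
`stub_argumentSectorComplete`. [cite: KontsevichZagier2001, §1.2] -/
theorem TorsionSectorComplete_of : TorsionSectorComplete := by
  suffices key : ArgumentPrimitiveChain → AnglePackaging → ArgumentSectorComplete → TorsionSectorComplete from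
    key stub_divisionArgumentChain stub_anglePackaging stub_argumentSectorComplete
  intro hA hB hD
  rw [torsionSectorComplete_iff]
  intro n m r r' hr hr' hv
  exact sup_closure_le_of_chain_packaging hA hB (hD r r' hr hr' hv)

end Summit.KontsevichZagierPeriods.KontsevichZagierPeriods.Cruxes.TorsionSectorComplete.NeronTorsionArgument

end
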